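import Summits.Ventures.PercRepro.PuncturedLYMProfile

/-!
# PercRepro — (SP) BY SUPERPOSITION, PART 5: THE PROFILE BOUND `Σ_B e(a_B(X)) ≤ j/(n − j + 1)` (p10, gen 31)

With the packing count of PuncturedLYMProfile (`#{B ∈ D : #(X ∩ B) = a}·(j − a) ≤ C(j,a)·C(n−j, j−1−a)`):
* `eDef_mul_eq` — `(C(j,a)C(n−j,j−1−a)/(j−a))·e(a) = τ·C_{≤a}/((n−2j+a)(n−2j+a+1))` (two binomial absorptions);
* `abel_sum`, `sum_classCount_lt`, `sum_classCount_div`, `sum_tele_eq` — `Σ_{a<j} τ·C_{≤a}/((n−2j+a)(n−2j+a+1)) =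
  j/(n−j+1)` (Abel summation, the absorption `C(N,k)(N+1) = C(N+1,k)(N+1−k)` and Vandermonde);
* `sum_eDef_le` — **`N(X) = Σ_{B ∈ D} e(#(X ∩ B)) ≤ j/(n − j + 1)` for every code `D`, every `j`-set `X ∉ D`,
  `1 ≤ j`, `2j + 1 ≤ n`.**
Nothing here asserts (SP).
-/

namespace PercRepro.PuncturedLYM

open Finset

variable {α : Type} [Fintype α] [DecidableEq α]

/-! ### The arithmetic of one class -/

omit [DecidableEq α] in
/-- `(C(j,a)·C(n−j, j−1−a)/(j−a))·e(a) = τ·C_{≤a}/((n−2j+a)(n−2j+a+1))` for `a < j`, `2j + 1 ≤ n`. -/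
theorem eDef_mul_eq {j a : ℕ} (ha : a < j) (hn : 2 * j + 1 ≤ Fintype.card α) :
    ((j.choose a * (Fintype.card α - j).choose (j - 1 - a) : ℕ) : ℚ) / ((j : ℚ) - a) * eDef α j a =
      tauQ α j * (cumCount (Fintype.card α) j a : ℚ) /
        (((Fintype.card α : ℚ) - 2 * j + a) * ((Fintype.card α : ℚ) - 2 * j + a + 1)) := by
  obtain ⟨n, hn_def⟩ : ∃ n, Fintype.card α = n := ⟨_, rfl⟩
  unfold eDef dFlux
  simp only [hn_def] at hn ⊢
  have hcut : cutEdges n j a = classCount n j a * (j + 1 - a) * (j - a) := rfl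
  have hcc : classCount n j a = j.choose a * (n - j).choose (j + 1 - a) := rfl
  -- the absorption identity `C(N, t−2)·(N−t+1)(N−t+2) = C(N, t)·t(t−1)` with `N = n − j`, `t = j + 1 − a`
  have habs : (n - j).choose (j - 1 - a) * (n - 2 * j + a) * (n - 2 * j + a + 1) =
      (n - j).choose (j + 1 - a) * (j + 1 - a) * (j - a) := by
    have e1 := Nat.choose_succ_right_eq (n - j) (j - a)
    have e2 := Nat.choose_succ_right_eq (n - j) (j - 1 - a)
    have h1 : j - a + 1 = j + 1 - a := by omega
    have h2 : j - 1 - a + 1 = j - a := by omega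
    have h3 : n - j - (j - a) = n - 2 * j + a := by omega
    have h4 : n - j - (j - 1 - a) = n - 2 * j + a + 1 := by omega
    rw [h1, h3] at e1
    rw [h2, h4] at e2
    calc (n - j).choose (j - 1 - a) * (n - 2 * j + a) * (n - 2 * j + a + 1)
        = (n - j).choose (j - 1 - a) * (n - 2 * j + a + 1) * (n - 2 * j + a) := by ring
      _ = (n - j).choose (j - a) * (j - a) * (n - 2 * j + a) := by rw [← e2]
      _ = (n - j).choose (j - a) * (n - 2 * j + a) * (j - a) := by ring
      _ = (n - j).choose (j + 1 - a) * (j + 1 - a) * (j - a) := by rw [← e1]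
  have hja : ((j : ℚ) - a) ≠ 0 := by
    have : (a : ℚ) < j := by exact_mod_cast ha
    linarith
  have hja1 : ((j : ℚ) + 1 - a) ≠ 0 := by
    have : (a : ℚ) < j := by exact_mod_cast ha
    linarith
  have hpos1 : ((n : ℚ) - 2 * j + a) ≠ 0 := by
    have : (2 * j + 1 : ℚ) ≤ n := by exact_mod_cast hn
    have : (0 : ℚ) ≤ a := by positivity
    linarith
  have hpos2 : ((n : ℚ) - 2 * j + a + 1) ≠ 0 := by
    have : (2 * j + 1 : ℚ) ≤ n := by exact_mod_cast hn
    have : (0 : ℚ) ≤ a := by positivity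
    linarith
  have hcpos : ((n - j).choose (j + 1 - a) : ℚ) ≠ 0 := by
    have : 0 < (n - j).choose (j + 1 - a) := Nat.choose_pos (by omega)
    exact_mod_cast this.ne'
  have hjpos : (j.choose a : ℚ) ≠ 0 := by
    have : 0 < j.choose a := Nat.choose_pos ha.le
    exact_mod_cast this.ne'
  -- cast the absorption identity
  have habsq : ((n - j).choose (j - 1 - a) : ℚ) * ((n : ℚ) - 2 * j + a) * ((n : ℚ) - 2 * j + a + 1) =
      ((n - j).choose (j + 1 - a) : ℚ) * ((j : ℚ) + 1 - a) * ((j : ℚ) - a) := by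
    have := congrArg (fun x : ℕ => (x : ℚ)) habs
    push_cast [Nat.cast_sub (by omega : 2 * j ≤ n), Nat.cast_sub (by omega : a ≤ j + 1),
      Nat.cast_sub ha.le] at this
    linear_combination this
  -- substitute `C(N, j−1−a)` from the absorption identity; the rest is a rational identity
  have hsub : ((n - j).choose (j - 1 - a) : ℚ) =
      ((n - j).choose (j + 1 - a) : ℚ) * ((j : ℚ) + 1 - a) * ((j : ℚ) - a) /
        (((n : ℚ) - 2 * j + a) * ((n : ℚ) - 2 * j + a + 1)) := by
    rw [eq_div_iff (mul_ne_zero hpos1 hpos2)]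
    linear_combination habsq
  rw [hcut, hcc]
  push_cast [Nat.cast_sub (by omega : a ≤ j + 1), Nat.cast_sub ha.le]
  rw [hsub]
  field_simp

/-! ### Abel summation and the telescoped sum -/

/-- Abel summation: with `Cum k = Σ_{i<k} c i`, `Σ_{a<k} Cum (a+1)·(f a − f (a+1)) + Cum k · f k = Σ_{a<k} c a · f a`. -/
theorem abel_sum (c f : ℕ → ℚ) (k : ℕ) :
    (∑ a ∈ range k, (∑ i ∈ range (a + 1), c i) * (f a - f (a + 1))) + (∑ i ∈ range k, c i) * f k =
      ∑ a ∈ range k, c a * f a := by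
  induction k with
  | zero => simp
  | succ k ih =>
    rw [sum_range_succ, sum_range_succ (fun a => c a * f a), sum_range_succ c]
    linear_combination ih

omit [DecidableEq α] in
/-- `Σ_{i<j} classCount i = C(n, j+1) − (n − j)` for `j < n`. -/
theorem sum_classCount_lt {j : ℕ} (hjn : j < Fintype.card α) :
    ∑ i ∈ range j, (classCount (Fintype.card α) j i : ℚ) =
      ((Fintype.card α).choose (j + 1) : ℚ) - ((Fintype.card α : ℚ) - j) := by
  have hV := sum_classCount (n := Fintype.card α) (j := j) hjn.le
  unfold cumCount at hV
  rw [sum_range_succ, sum_range_succ] at hV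
  have h1 : classCount (Fintype.card α) j (j + 1) = 0 := by
    unfold classCount
    rw [Nat.choose_succ_self, zero_mul]
  have h2 : classCount (Fintype.card α) j j = Fintype.card α - j := by
    unfold classCount
    have : j + 1 - j = 1 := by omega
    rw [Nat.choose_self, one_mul, this, Nat.choose_one_right]
  rw [h1, h2, add_zero] at hV
  have : (((∑ i ∈ range j, classCount (Fintype.card α) j i) + (Fintype.card α - j) : ℕ) : ℚ) =
      ((Fintype.card α).choose (j + 1) : ℚ) := by exact_mod_cast hV
  push_cast [Nat.cast_sub hjn.le] at this
  linarith

omit [DecidableEq α] in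
/-- `Σ_{a<j} classCount a / (n − 2j + a) = (C(n+1, j+1) − (n − j + 1)) / (n − j + 1)` for `2j + 1 ≤ n`
(absorption `C(N, k)(N + 1) = C(N+1, k)(N + 1 − k)` and Vandermonde). -/
theorem sum_classCount_div {j : ℕ} (hn : 2 * j + 1 ≤ Fintype.card α) :
    ∑ a ∈ range j, (classCount (Fintype.card α) j a : ℚ) / ((Fintype.card α : ℚ) - 2 * j + a) =
      (((Fintype.card α + 1).choose (j + 1) : ℚ) - ((Fintype.card α : ℚ) - j + 1)) / ((Fintype.card α : ℚ) - j + 1) := by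
  obtain ⟨n, hn_def⟩ : ∃ n, Fintype.card α = n := ⟨_, rfl⟩
  simp only [hn_def] at hn ⊢
  have hN1 : ((n : ℚ) - j + 1) ≠ 0 := by
    have : (2 * j + 1 : ℚ) ≤ n := by exact_mod_cast hn
    linarith
  -- termwise absorption
  have hterm : ∀ a ∈ range j, (classCount n j a : ℚ) / ((n : ℚ) - 2 * j + a) =
      ((j.choose a * (n - j + 1).choose (j + 1 - a) : ℕ) : ℚ) / ((n : ℚ) - j + 1) := by
    intro a ha
    rw [mem_range] at ha
    have habs := Nat.choose_mul_succ_eq (n - j) (j + 1 - a)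
    have h1 : n - j + 1 - (j + 1 - a) = n - 2 * j + a := by omega
    rw [h1] at habs
    have hpos : ((n : ℚ) - 2 * j + a) ≠ 0 := by
      have : (2 * j + 1 : ℚ) ≤ n := by exact_mod_cast hn
      have : (0 : ℚ) ≤ a := by positivity
      linarith
    unfold classCount
    rw [div_eq_div_iff hpos hN1]
    have := congrArg (fun x : ℕ => (x : ℚ)) habs
    push_cast [Nat.cast_sub (by omega : 2 * j ≤ n), Nat.cast_sub (by omega : j ≤ n)] at this
    push_cast
    linear_combination (j.choose a : ℚ) * this
  rw [sum_congr rfl hterm, ← sum_div]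
  congr 1
  -- Vandermonde on `j + (n − j + 1) = n + 1`
  have hV : ∑ a ∈ range (j + 2), j.choose a * (n - j + 1).choose (j + 1 - a) = (n + 1).choose (j + 1) := by
    have := Nat.add_choose_eq j (n - j + 1) (j + 1)
    rw [Nat.sum_antidiagonal_eq_sum_range_succ_mk] at this
    have hnj : j + (n - j + 1) = n + 1 := by omega
    rw [hnj] at this
    rw [this]
  rw [sum_range_succ, sum_range_succ] at hV
  have h1 : j.choose (j + 1) * (n - j + 1).choose (j + 1 - (j + 1)) = 0 := by
    rw [Nat.choose_succ_self, zero_mul]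
  have h2 : j.choose j * (n - j + 1).choose (j + 1 - j) = n - j + 1 := by
    rw [Nat.choose_self, one_mul]
    have : j + 1 - j = 1 := by omega
    rw [this, Nat.choose_one_right]
  rw [h1, h2, add_zero] at hV
  have : ((∑ a ∈ range j, j.choose a * (n - j + 1).choose (j + 1 - a) + (n - j + 1) : ℕ) : ℚ) =
      ((n + 1).choose (j + 1) : ℚ) := by exact_mod_cast hV
  push_cast [Nat.cast_sub (by omega : j ≤ n)] at this
  push_cast
  linarith

omit [DecidableEq α] in
/-- **The telescoped sum**: `Σ_{a<j} τ·C_{≤a}/((n−2j+a)(n−2j+a+1)) = j/(n − j + 1)` for `1 ≤ j`, `2j + 1 ≤ n`. -/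
theorem sum_tele_eq {j : ℕ} (hj : 1 ≤ j) (hn : 2 * j + 1 ≤ Fintype.card α) :
    ∑ a ∈ range j, tauQ α j * (cumCount (Fintype.card α) j a : ℚ) /
        (((Fintype.card α : ℚ) - 2 * j + a) * ((Fintype.card α : ℚ) - 2 * j + a + 1)) =
      (j : ℚ) / ((Fintype.card α : ℚ) - j + 1) := by
  obtain ⟨n, hn_def⟩ : ∃ n, Fintype.card α = n := ⟨_, rfl⟩
  have hτ := tauQ_mul_choose (α := α) (j := j) (by omega)
  have hS1' := sum_classCount_div (α := α) hn
  have hS2' := sum_classCount_lt (α := α) (j := j) (by omega)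
  unfold tauQ at hτ ⊢
  simp only [hn_def] at hn hτ hS1' hS2' ⊢
  have hjn : j < n := by omega
  have hnq : (2 * j + 1 : ℚ) ≤ n := by exact_mod_cast hn
  set c : ℕ → ℚ := fun i => (classCount n j i : ℚ) with hc
  set f : ℕ → ℚ := fun a => 1 / ((n : ℚ) - 2 * j + a) with hf
  set τ : ℚ := ((n : ℚ) - j) / (n.choose (j + 1) : ℕ) with hτdef
  have key : ∀ (x P : ℚ), P ≠ 0 → P + 1 ≠ 0 → x / (P * (P + 1)) = x * (1 / P - 1 / (P + 1)) := by
    intro x P h1 h2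
    field_simp
    ring
  -- partial fractions: each term is `τ · Cum (a+1) · (f a − f (a+1))`
  have hpf : ∀ a ∈ range j, τ * (cumCount n j a : ℚ) /
      (((n : ℚ) - 2 * j + a) * ((n : ℚ) - 2 * j + a + 1)) =
      τ * ((∑ i ∈ range (a + 1), c i) * (f a - f (a + 1))) := by
    intro a ha
    have hpos : ((n : ℚ) - 2 * j + a) ≠ 0 := by
      have : (0 : ℚ) ≤ a := by positivity
      linarith
    have hpos2 : ((n : ℚ) - 2 * j + a + 1) ≠ 0 := by
      have : (0 : ℚ) ≤ a := by positivity
      linarith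
    have hcum : (cumCount n j a : ℚ) = ∑ i ∈ range (a + 1), c i := by
      unfold cumCount
      push_cast
      rfl
    have hf1 : f (a + 1) = 1 / (((n : ℚ) - 2 * j + a) + 1) := by
      rw [hf]
      simp only
      push_cast
      ring_nf
    have hf0 : f a = 1 / ((n : ℚ) - 2 * j + a) := by rw [hf]
    rw [hcum, hf1, hf0, key _ _ hpos hpos2]
    ring
  rw [sum_congr rfl hpf, ← mul_sum]
  have hA := abel_sum c f j
  have hS1 : ∑ a ∈ range j, c a * f a =
      (((n + 1).choose (j + 1) : ℚ) - ((n : ℚ) - j + 1)) / ((n : ℚ) - j + 1) := by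
    rw [← hS1']
    apply sum_congr rfl
    intro a _
    rw [hc, hf]
    simp only
    ring
  have hS2 : ∑ i ∈ range j, c i = ((n).choose (j + 1) : ℚ) - ((n : ℚ) - j) := by
    rw [hc]
    exact hS2'
  have hfj : f j = 1 / ((n : ℚ) - j) := by
    rw [hf]
    simp only
    ring_nf
  have hsum : ∑ a ∈ range j, (∑ i ∈ range (a + 1), c i) * (f a - f (a + 1)) =
      (((n + 1).choose (j + 1) : ℚ) - ((n : ℚ) - j + 1)) / ((n : ℚ) - j + 1) -
        (((n).choose (j + 1) : ℚ) - ((n : ℚ) - j)) * (1 / ((n : ℚ) - j)) := by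
    rw [← hS1, ← hS2, ← hfj]
    linarith
  rw [hsum]
  -- `τ·C(n, j+1) = n − j` and `C(n+1, j+1)(n − j) = (n + 1)·C(n, j+1)`
  have hch : ((n + 1).choose (j + 1) : ℚ) * ((n : ℚ) - j) = ((n : ℚ) + 1) * (n.choose (j + 1) : ℚ) := by
    have := Nat.choose_mul_succ_eq n (j + 1)
    have h1 : n + 1 - (j + 1) = n - j := by omega
    rw [h1] at this
    have := congrArg (fun x : ℕ => (x : ℚ)) this
    push_cast [Nat.cast_sub hjn.le] at this
    linarith
  have hN : ((n : ℚ) - j) ≠ 0 := by linarith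
  have hN1 : ((n : ℚ) - j + 1) ≠ 0 := by linarith
  have hYpos : (n.choose (j + 1) : ℚ) ≠ 0 := by
    have : 0 < n.choose (j + 1) := Nat.choose_pos hjn
    exact_mod_cast this.ne'
  have hCn1 : ((n + 1).choose (j + 1) : ℚ) = ((n : ℚ) + 1) * (n.choose (j + 1) : ℚ) / ((n : ℚ) - j) := by
    rw [eq_div_iff hN]
    linarith [hch]
  rw [hCn1, hτdef]
  field_simp
  ring

/-! ### The profile bound -/

/-- **`N(X) = Σ_{B ∈ D} e(#(X ∩ B)) ≤ j/(n − j + 1)`** for every code `D`, every `j`-set `X ∉ D`, `1 ≤ j`, `2j + 1 ≤ n`. -/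
theorem sum_eDef_le {j : ℕ} {D : Finset (Finset α)} (hD : IsCode j D) (hj : 1 ≤ j) (hn : 2 * j + 1 ≤ Fintype.card α)
    {X : Finset α} (hX : X.card = j) (hXD : X ∉ D) :
    ∑ B ∈ D, eDef α j (X ∩ B).card ≤ (j : ℚ) / ((Fintype.card α : ℚ) - j + 1) := by
  have hjn : j ≤ Fintype.card α := by omega
  -- group by the distance `a = #(X ∩ B) < j`
  have hmaps : ∀ B ∈ D, (X ∩ B).card ∈ range j := by
    intro B hB
    rw [mem_range]
    have hne : X ≠ B := fun h => hXD (h ▸ hB)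
    have := aOf_lt (hD.1 B hB) hX hne
    exact this
  rw [← sum_fiberwise_of_maps_to hmaps]
  -- each fibre: `m_a · e(a) ≤ (s_a/(j − a)) · e(a)`
  have hfib : ∀ a ∈ range j, ∑ B ∈ D.filter (fun B => (X ∩ B).card = a), eDef α j (X ∩ B).card ≤
      ((j.choose a * (Fintype.card α - j).choose (j - 1 - a) : ℕ) : ℚ) / ((j : ℚ) - a) * eDef α j a := by
    intro a ha
    rw [mem_range] at ha
    have h1 : ∑ B ∈ D.filter (fun B => (X ∩ B).card = a), eDef α j (X ∩ B).card =
        ((D.filter (fun B => (X ∩ B).card = a)).card : ℚ) * eDef α j a := by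
      rw [← nsmul_eq_mul, ← sum_const]
      apply sum_congr rfl
      intro B hB
      rw [(mem_filter.1 hB).2]
    rw [h1]
    apply mul_le_mul_of_nonneg_right _ (eDef_nonneg ha.le hjn)
    have hpack := card_profile_mul_le hD hX ha
    rw [card_midSets hX (by omega)] at hpack
    have hja : (0 : ℚ) < (j : ℚ) - a := by
      have : (a : ℚ) < j := by exact_mod_cast ha
      linarith
    rw [le_div_iff₀ hja]
    have : (((D.filter (fun B => (X ∩ B).card = a)).card * (j - a) : ℕ) : ℚ) ≤
        ((j.choose a * (Fintype.card α - j).choose (j - 1 - a) : ℕ) : ℚ) := by exact_mod_cast hpack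
    push_cast [Nat.cast_sub ha.le] at this
    push_cast
    linarith
  calc ∑ a ∈ range j, ∑ B ∈ D.filter (fun B => (X ∩ B).card = a), eDef α j (X ∩ B).card
      ≤ ∑ a ∈ range j, ((j.choose a * (Fintype.card α - j).choose (j - 1 - a) : ℕ) : ℚ) / ((j : ℚ) - a) *
          eDef α j a := sum_le_sum hfib
    _ = ∑ a ∈ range j, tauQ α j * (cumCount (Fintype.card α) j a : ℚ) /
          (((Fintype.card α : ℚ) - 2 * j + a) * ((Fintype.card α : ℚ) - 2 * j + a + 1)) := by
        apply sum_congr rfl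
        intro a ha
        exact eDef_mul_eq (mem_range.1 ha) hn
    _ = (j : ℚ) / ((Fintype.card α : ℚ) - j + 1) := sum_tele_eq hj hn

end PercRepro.PuncturedLYM
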